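import Summits.NavierStokesRegularity.FluidComputer.SmoothedHillVortexField
import Mathlib.Analysis.SpecialFunctions.JapaneseBracket
import HarnessLib

/-!
# The smoothed Hill spherical vortex, V: the dipole tail is homogeneous — all derivatives are
# square integrable (`H^∞`)

Cell `ns-blowup`, seat `ns-blowup-fc-prover-3` (g6); sequel of `SmoothedHillVortexField` (IV).
LABEL: kinematics (proved lemmas; no named fact). WHAT THIS IS NOT: not NS evidence — regularity
bookkeeping of an explicit field (the LAZY ENVELOPE SLICE of crux `HeredityAtOne`'s negative lane,
stmt-NavierStokesRegularity-19249), needed because Tao's `H^∞` local theory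
(`IsTaoSolutionOn`, `exists_isTaoSolutionOn_of_noSwirl`) asks `∫ ‖Dⁿu₀‖² < ∞` for every `n`.

The smoothed Hill vortex is NOT Schwartz (a single-signed `ω_θ/r` forces the `|x|⁻³` dipole tail),
but it is `H^∞`: outside the ball of radius `b` it is EXACTLY `K ·` (point-dipole field), which is
homogeneous of degree `−3`, so `Dⁿu` is homogeneous of degree `−3−n` there; with the compact core this
gives `‖Dⁿu(y)‖ ≤ Cₙ (1 + ‖y‖)⁻³`, square integrable on `(EuclideanSpace ℝ (Fin 3))`.

* `hillField_smul_of_ge` — `u(c x) = c⁻³ u(x)` for `|x| ≥ b`, `c ≥ 1`;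
* `iteratedFDeriv_hillField_smul` — `Dⁿu(c x) = c^{−(n+3)} Dⁿu(x)` for `|x| > b`, `c ≥ 1`
  (chain rule for the linear map `c • id`, locality of `iteratedFDeriv`, `map_smul_univ`);
* `exists_norm_iteratedFDeriv_hillField_le` — `‖Dⁿu(y)‖ ≤ Cₙ ((1 + ‖y‖)³)⁻¹`;
* **`lintegral_iteratedFDeriv_hillField_lt_top`** — `∫ ‖Dⁿu‖² < ∞` for every `n`.

References: M. J. M. Hill, Phil. Trans. R. Soc. London A 185 (1894) 213–245 [cite: Hill1894, Art. 1–4];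
D. J. Acheson, *Elementary Fluid Dynamics* (OUP 1990) §5.5 [cite: Acheson1990, §5.5, eq. (5.21)].
-/

noncomputable section

open Real Set Function MeasureTheory Filter Topology
open scoped ContDiff ENNReal

namespace Summit.NavierStokesRegularity.FluidComputer

namespace SmoothedHill

open Literature.Analysis.FluidPDE

variable {M a b : ℝ}

/-! ## Homogeneity of the dipole tail -/

/-- `rsq (c • x) = c² rsq x`. [folklore] -/
theorem rsq_smul (c : ℝ) (x : (EuclideanSpace ℝ (Fin 3))) : rsq (c • x) = c ^ 2 * rsq x := by
  simp only [rsq, PiLp.smul_apply, smul_eq_mul]; ring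

/-- **The dipole tail is homogeneous of degree `−3`**: `u(c x) = c⁻³ u(x)` for `|x|² ≥ b²` and
`c ≥ 1`. [cite: Acheson1990, §5.5, eq. (5.21)] -/
theorem hillField_smul_of_ge (ha : 0 < a) (hab : a < b) {x : (EuclideanSpace ℝ (Fin 3))} (hx : b ^ 2 ≤ rsq x) {c : ℝ}
    (hc : 1 ≤ c) : hillField M a b (c • x) = (c ^ 3)⁻¹ • hillField M a b x := by
  have hb : 0 < b := ha.trans hab
  have hc0 : 0 < c := lt_of_lt_of_le one_pos hc
  have hx0 : 0 < ‖x‖ := by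
    have h : 0 < rsq x := lt_of_lt_of_le (by positivity) hx
    rw [rsq_eq_norm_sq] at h
    exact lt_of_le_of_ne (norm_nonneg _) fun h0 => by rw [← h0] at h; simp at h
  have hcx : b ^ 2 ≤ rsq (c • x) := by
    rw [rsq_smul]
    have : rsq x ≤ c ^ 2 * rsq x := le_mul_of_one_le_left (rsq_nonneg x) (by nlinarith)
    exact hx.trans this
  have hn : ‖c • x‖ = c * ‖x‖ := by rw [norm_smul, Real.norm_of_nonneg hc0.le]
  rw [hillField_of_ge ha hab hcx, hillField_of_ge ha hab hx, smul_smul]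
  ext i
  fin_cases i
  · show tailConst M a b * ((c • x) 0 * (c • x) 2 / ‖c • x‖ ^ 5) =
      (c ^ 3)⁻¹ * tailConst M a b * (x 0 * x 2 / ‖x‖ ^ 5)
    rw [hn, PiLp.smul_apply, PiLp.smul_apply, smul_eq_mul, smul_eq_mul]
    field_simp
  · show tailConst M a b * ((c • x) 1 * (c • x) 2 / ‖c • x‖ ^ 5) =
      (c ^ 3)⁻¹ * tailConst M a b * (x 1 * x 2 / ‖x‖ ^ 5)
    rw [hn, PiLp.smul_apply, PiLp.smul_apply, smul_eq_mul, smul_eq_mul]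
    field_simp
  · show tailConst M a b * (2 / 3 / ‖c • x‖ ^ 3 - ((c • x) 0 ^ 2 + (c • x) 1 ^ 2) / ‖c • x‖ ^ 5) =
      (c ^ 3)⁻¹ * tailConst M a b * (2 / 3 / ‖x‖ ^ 3 - (x 0 ^ 2 + x 1 ^ 2) / ‖x‖ ^ 5)
    rw [hn, PiLp.smul_apply, PiLp.smul_apply, smul_eq_mul, smul_eq_mul]
    field_simp

/-- A continuous multilinear map precomposed with the dilation `c • id` in every slot is
`c ^ n •` itself. [folklore] -/
theorem compContinuousLinearMap_smul_id {n : ℕ} (A : ContinuousMultilinearMap ℝ (fun _ : Fin n => (EuclideanSpace ℝ (Fin 3))) (EuclideanSpace ℝ (Fin 3)))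
    (c : ℝ) : A.compContinuousLinearMap (fun _ => c • ContinuousLinearMap.id ℝ (EuclideanSpace ℝ (Fin 3))) = c ^ n • A := by
  apply ContinuousMultilinearMap.ext
  intro v
  have h := A.map_smul_univ (fun _ => c) v
  rw [Finset.prod_const, Finset.card_univ, Fintype.card_fin] at h
  rw [ContinuousMultilinearMap.compContinuousLinearMap_apply, smul_apply, ← h]
  rfl

/-- **`Dⁿu(c x) = c^{−(n+3)} Dⁿu(x)`** on the OPEN tail `|x|² > b²`, `c ≥ 1`: the `n`-th derivative
of the dipole tail is homogeneous of degree `−3−n`. [folklore] -/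
theorem iteratedFDeriv_hillField_smul (ha : 0 < a) (hab : a < b) {x : (EuclideanSpace ℝ (Fin 3))} (hx : b ^ 2 < rsq x)
    {c : ℝ} (hc : 1 ≤ c) (n : ℕ) :
    iteratedFDeriv ℝ n (hillField M a b) (c • x) =
      (c ^ (n + 3))⁻¹ • iteratedFDeriv ℝ n (hillField M a b) x := by
  have hc0 : 0 < c := lt_of_lt_of_le one_pos hc
  set g : (EuclideanSpace ℝ (Fin 3)) →L[ℝ] (EuclideanSpace ℝ (Fin 3)) := c • ContinuousLinearMap.id ℝ (EuclideanSpace ℝ (Fin 3)) with hg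
  have hgx : ∀ y : (EuclideanSpace ℝ (Fin 3)), g y = c • y := fun y => by simp [hg]
  -- chain rule for the linear dilation
  have h1 : iteratedFDeriv ℝ n (hillField M a b ∘ g) x =
      (iteratedFDeriv ℝ n (hillField M a b) (g x)).compContinuousLinearMap fun _ => g :=
    g.iteratedFDeriv_comp_right (contDiff_hillField M a b (n := n)) x le_rfl
  -- locality: on the open tail, `u ∘ g = c⁻³ • u`
  have hopen : IsOpen {y : (EuclideanSpace ℝ (Fin 3)) | b ^ 2 < rsq y} :=
    isOpen_lt continuous_const (contDiff_rsq (n := 0)).continuous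
  have h2 : (hillField M a b ∘ g) =ᶠ[𝓝 x] ((c ^ 3)⁻¹ • hillField M a b) := by
    filter_upwards [hopen.mem_nhds hx] with y hy
    simp only [comp_apply, hgx, Pi.smul_apply]
    exact hillField_smul_of_ge ha hab hy.le hc
  have h3 := (h2.iteratedFDeriv ℝ n).eq_of_nhds
  have h4 : iteratedFDeriv ℝ n ((c ^ 3)⁻¹ • hillField M a b) x =
      (c ^ 3)⁻¹ • iteratedFDeriv ℝ n (hillField M a b) x :=
    iteratedFDeriv_const_smul_apply ((contDiff_hillField M a b (n := n)).contDiffAt)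
  rw [h1, compContinuousLinearMap_smul_id, hgx, h4] at h3
  -- `c^n • D(cx) = c⁻³ • D(x)`
  have hcn : (c ^ n : ℝ) ≠ 0 := pow_ne_zero _ hc0.ne'
  calc iteratedFDeriv ℝ n (hillField M a b) (c • x)
      = (c ^ n)⁻¹ • (c ^ n • iteratedFDeriv ℝ n (hillField M a b) (c • x)) := by
        rw [smul_smul, inv_mul_cancel₀ hcn, one_smul]
    _ = (c ^ n)⁻¹ • ((c ^ 3)⁻¹ • iteratedFDeriv ℝ n (hillField M a b) x) := by rw [h3]
    _ = (c ^ (n + 3))⁻¹ • iteratedFDeriv ℝ n (hillField M a b) x := by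
        rw [smul_smul, pow_add, mul_inv]

/-! ## Decay of all derivatives -/

/-- **`‖Dⁿu(y)‖ ≤ Cₙ ((1 + ‖y‖)³)⁻¹` for all `y`** (`0 < a < b`): compactness on the closed ball of
radius `b + 1`, homogeneity of degree `−3−n` outside. [folklore] -/
theorem exists_norm_iteratedFDeriv_hillField_le (ha : 0 < a) (hab : a < b) (n : ℕ) :
    ∃ C : ℝ, 0 ≤ C ∧ ∀ y : (EuclideanSpace ℝ (Fin 3)),
      ‖iteratedFDeriv ℝ n (hillField M a b) y‖ ≤ C * ((1 + ‖y‖) ^ 3)⁻¹ := by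
  have hb : 0 < b := ha.trans hab
  set R : ℝ := b + 1 with hR
  have hR1 : 1 ≤ R := by rw [hR]; linarith
  have hR0 : 0 < R := by linarith
  have hcont : Continuous fun y => iteratedFDeriv ℝ n (hillField M a b) y :=
    (contDiff_hillField M a b (n := n)).continuous_iteratedFDeriv le_rfl
  obtain ⟨C₁, hC₁⟩ := (isCompact_closedBall (0 : (EuclideanSpace ℝ (Fin 3))) R).exists_bound_of_continuousOn
    hcont.continuousOn
  obtain ⟨C₂, hC₂⟩ := (isCompact_sphere (0 : (EuclideanSpace ℝ (Fin 3))) R).exists_bound_of_continuousOn hcont.continuousOn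
  have hC₁0 : 0 ≤ C₁ := le_trans (norm_nonneg _) (hC₁ 0 (by simp [hR0.le]))
  have hC₂0 : 0 ≤ C₂ := by
    have hmem : (R • EuclideanSpace.single (0 : Fin 3) (1 : ℝ) : (EuclideanSpace ℝ (Fin 3))) ∈ Metric.sphere (0 : (EuclideanSpace ℝ (Fin 3))) R := by
      simp [norm_smul, abs_of_pos hR0]
    exact le_trans (norm_nonneg _) (hC₂ _ hmem)
  refine ⟨max (C₁ * (1 + R) ^ 3) (C₂ * (2 * R) ^ 3), le_max_of_le_left (by positivity), fun y => ?_⟩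
  have hy1 : 0 < (1 + ‖y‖) ^ 3 := by positivity
  rcases le_or_gt ‖y‖ R with hy | hy
  · -- inside the closed ball
    have h := hC₁ y (by simpa using hy)
    calc ‖iteratedFDeriv ℝ n (hillField M a b) y‖ ≤ C₁ := h
      _ = C₁ * (1 + ‖y‖) ^ 3 * ((1 + ‖y‖) ^ 3)⁻¹ := by field_simp
      _ ≤ C₁ * (1 + R) ^ 3 * ((1 + ‖y‖) ^ 3)⁻¹ := by gcongr
      _ ≤ max (C₁ * (1 + R) ^ 3) (C₂ * (2 * R) ^ 3) * ((1 + ‖y‖) ^ 3)⁻¹ :=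
          mul_le_mul_of_nonneg_right (le_max_left _ _) (by positivity)
  · -- in the tail: scale back to the sphere of radius R
    have hy0 : 0 < ‖y‖ := hR0.trans hy
    set c : ℝ := ‖y‖ / R with hc
    have hc1 : 1 ≤ c := by rw [hc, le_div_iff₀ hR0]; linarith
    have hc0 : 0 < c := lt_of_lt_of_le one_pos hc1
    set x : (EuclideanSpace ℝ (Fin 3)) := c⁻¹ • y with hx
    have hyx : y = c • x := by rw [hx, smul_smul, mul_inv_cancel₀ hc0.ne', one_smul]
    have hxn : ‖x‖ = R := by
      rw [hx, norm_smul, Real.norm_of_nonneg (inv_nonneg.2 hc0.le), hc, inv_div]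
      field_simp
    have hxs : b ^ 2 < rsq x := by
      rw [rsq_eq_norm_sq, hxn, hR]; nlinarith
    have hhom := iteratedFDeriv_hillField_smul (M := M) ha hab hxs hc1 n
    rw [← hyx] at hhom
    have hDx : ‖iteratedFDeriv ℝ n (hillField M a b) x‖ ≤ C₂ := hC₂ x (by simp [hxn])
    rw [hhom, norm_smul, norm_inv, norm_pow, Real.norm_of_nonneg hc0.le]
    -- (c^(n+3))⁻¹ C₂ ≤ c⁻³ C₂ = (R/‖y‖)³ C₂ ≤ C₂ (2R)³ (1+‖y‖)⁻³
    have hcpow : (c ^ (n + 3))⁻¹ ≤ (c ^ 3)⁻¹ := by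
      apply inv_anti₀ (pow_pos hc0 3)
      rw [pow_add]
      exact le_mul_of_one_le_left (pow_nonneg hc0.le 3) (one_le_pow₀ hc1)
    have hy2 : 1 + ‖y‖ ≤ 2 * ‖y‖ := by linarith [hR1.trans hy.le]
    have key : (c ^ 3)⁻¹ * C₂ ≤ C₂ * (2 * R) ^ 3 * ((1 + ‖y‖) ^ 3)⁻¹ := by
      rw [hc, div_pow, inv_div]
      rw [show C₂ * (2 * R) ^ 3 * ((1 + ‖y‖) ^ 3)⁻¹ = R ^ 3 * (2 ^ 3 * ((1 + ‖y‖) ^ 3)⁻¹) * C₂ by ring,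
        show R ^ 3 / ‖y‖ ^ 3 * C₂ = R ^ 3 * (‖y‖ ^ 3)⁻¹ * C₂ by ring]
      refine mul_le_mul_of_nonneg_right (mul_le_mul_of_nonneg_left ?_ (by positivity)) hC₂0
      have hx1 : 0 < 1 + ‖y‖ := by positivity
      rw [show (‖y‖ ^ 3)⁻¹ = (‖y‖⁻¹) ^ 3 by rw [inv_pow],
        show (2 : ℝ) ^ 3 * ((1 + ‖y‖) ^ 3)⁻¹ = (((1 + ‖y‖) / 2)⁻¹) ^ 3 by
          rw [inv_div, div_pow]; field_simp]
      apply pow_le_pow_left₀ (by positivity)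
      exact inv_anti₀ (by positivity) (by linarith)
    calc (c ^ (n + 3))⁻¹ * ‖iteratedFDeriv ℝ n (hillField M a b) x‖
        ≤ (c ^ 3)⁻¹ * C₂ := mul_le_mul hcpow hDx (norm_nonneg _) (by positivity)
      _ ≤ C₂ * (2 * R) ^ 3 * ((1 + ‖y‖) ^ 3)⁻¹ := key
      _ ≤ max (C₁ * (1 + R) ^ 3) (C₂ * (2 * R) ^ 3) * ((1 + ‖y‖) ^ 3)⁻¹ :=
          mul_le_mul_of_nonneg_right (le_max_right _ _) (by positivity)

/-- **The smoothed Hill vortex is `H^∞`**: `∫ ‖Dⁿu‖² < ∞` for every `n` (`0 < a < b`).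
[folklore] -/
theorem lintegral_iteratedFDeriv_hillField_lt_top (ha : 0 < a) (hab : a < b) (n : ℕ) :
    ∫⁻ x, ‖iteratedFDeriv ℝ n (hillField M a b) x‖ₑ ^ 2 < ⊤ := by
  obtain ⟨C, hC0, hC⟩ := exists_norm_iteratedFDeriv_hillField_le (M := M) ha hab n
  have hint : Integrable (fun x : (EuclideanSpace ℝ (Fin 3)) => C ^ 2 * (1 + ‖x‖) ^ (-(6 : ℝ))) :=
    (integrable_one_add_norm (by simp; norm_num)).const_mul _
  have hlt := hint.lintegral_lt_top
  refine lt_of_le_of_lt (lintegral_mono fun x => ?_) hlt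
  have hx1 : 0 < 1 + ‖x‖ := by positivity
  have hle : ‖iteratedFDeriv ℝ n (hillField M a b) x‖ ^ 2 ≤ C ^ 2 * (1 + ‖x‖) ^ (-(6 : ℝ)) := by
    have h := hC x
    have h2 : ‖iteratedFDeriv ℝ n (hillField M a b) x‖ ^ 2 ≤ (C * ((1 + ‖x‖) ^ 3)⁻¹) ^ 2 :=
      pow_le_pow_left₀ (norm_nonneg _) h 2
    have h3 : (C * ((1 + ‖x‖) ^ 3)⁻¹) ^ 2 = C ^ 2 * (1 + ‖x‖) ^ (-(6 : ℝ)) := by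
      rw [mul_pow, ← inv_pow, ← pow_mul, Real.rpow_neg hx1.le, show ((6 : ℝ)) = ((6 : ℕ) : ℝ) by norm_num,
        Real.rpow_natCast, inv_pow]
    linarith [h3.le, h3.ge]
  have hnn : 0 ≤ C ^ 2 * (1 + ‖x‖) ^ (-(6 : ℝ)) := by positivity
  rw [← ofReal_norm, ← ENNReal.ofReal_pow (norm_nonneg _)]
  exact ENNReal.ofReal_le_ofReal hle

end SmoothedHill

end Summit.NavierStokesRegularity.FluidComputer

end
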